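import Summits.BirchSwinnertonDyer.Rank1Residual.Partition.MainConjecturesEisensteinHeegner
import Summits.BirchSwinnertonDyer.Rank1Residual.Partition.TamagawaBaseChangeOdd
import HarnessLib

/-!
# Row C6 (good non-anomalous Eisenstein `p`), rank ONE, along the printed anticyclotomic route at the
# level of CGLS22 display (5.5) — at EVERY ODD `p` (the `p = 3` case of `MainConjecturesEisensteinHeegner.lean`)

HONEST FRAMING (cell `b2b-bsdres`, run/shared/lean/b2b/bsd-rank1-residual/; verbatim): the goal is to
DELETE the COMBINATION-SHAPED residual classes for ALL analytic-rank `≤ 1` curves over `ℚ` — "full BSD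
formula for every rank `≤ 1` curve in class `C`" assembled STRICTLY from published theorems — so
that the rank-`≤ 1` remainder becomes exactly the CONSTRUCTION-SHAPED classes, which are TYPED
(missing-input `Prop`s), NOT attempted; this is not "finishing BSD". NEW WORK of the cell (bookkeeping
over decls already in the tree), hence under `Summits/`; NO definition, NO named fact, nothing about
any particular curve asserted; no label moves (row C6 is COVERED [PUB] by CGS 2025 Thm. D, A47).
Unit `b2b-bsdres-lit-cgls` (off-peak literature typer: Castella–Grossi–Lee–Skinner 2022 /
Greenberg–Vatsal 2000), session 4.

## What this file does

`Partition/MainConjecturesEisensteinHeegner.lean` (session 3) carried row C6 ∩ {r = 1} from the typed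
display (5.5) (`CastellaGrossiLeeSkinner2022.display55_sha_heegnerIndex`, A157) through the cell's
rank-one currency `X11b.IndexIdentityAt` and the exact descent `X11b.bsdp_of_indexIdentityAt`, at
`p ≥ 5` only — because the two Tamagawa transports it needs (`ord_p ∏_w c_w(E/K) = 2·ord_p ∏_ℓ c_ℓ(E)`
and `ord_p ∏_ℓ c_ℓ(E^{(d_K)}) = ord_p ∏_ℓ c_ℓ(E)`) were tree theorems at `p ≥ 5`. Both are now
theorems at every ODD `p ∤ d_K` under the classical Heegner hypothesis with `d_K` odd
(`X11b.padicValNat_tamagawaProduct_baseChange_quadratic_eq_two_mul_of_heegner_of_odd`, session 4;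
`X2.padicValNat_tamagawaProduct_twist_of_heegner_of_odd`, eisenstein-p2), and on the row's admissible
`K` the prime `p` splits, so `p ∤ d_K`. This file re-runs §1–§3 of the session-3 file with `5 ≤ p`
replaced by `2 < p` — CGLS22 Thm. 5.3.1 / CGS25 Thm. D are printed for `p > 2`:

1. `RowC6.indexIdentityAt_of_display55_of_odd`, `RowC6.indexLowerBoundAt_of_display55_of_odd` —
   (5.5) at a datum with `p ∤ c_E` ⇒ `X11b.IndexIdentityAt` / STEP L, every odd `p`.
2. `RowC6.bsdp_rankOne_at_of_display55_of_partner_of_odd`, `…_of_cgsThmA_of_odd` — pointwise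
   descent with the partner's rank-zero shape (resp. CGS Thm. A supplying it).
3. `RowC6.bsdp_rankOne_of_display55_of_cgsThmA_of_odd` (+ row vocabulary `'`) — CLASS LEVEL at every
   odd `p`: ∀ globally minimal `E`, `p > 2` good Eisenstein non-anomalous, `ord_{s=1}L(E,s) = 1` ⇒
   `BSD(E,p)`, from (5.5) + Thm. A + published facts (optimal curve by Mazur Cor. 4.1 + Cassels), as in
   session 3. So row C6 ∩ {r = 1} reads "(5.5) ⇒ Heegner-index identity ⇒ exact descent" at `p = 3`
   too; the (5.7)-level route of `MainConjecturesEisenstein.lean` §4 is no longer needed for `p = 3`.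

References: [CastellaGrossiLeeSkinner2022] proof of Thm. 5.3.1 (5.4)–(5.7); [CastellaGrossiSkinner2025]
Thm. A, Thm. D; [JetchevSkinnerWan2017] §7.3.1 (eq:tamK), §7.4.1; [GrossZagier1986] V.§2; [Mazur1978]
Cor. 4.1; [GreenbergLNM1716] Thm. 4.1; [HoffsteinLuo1997]; [Miller2011LMS] Def. 1.1. Deliverable:
HOME/b2b-bsdres-lit-cgls/CGLS-GV-TYPING.md §11 (session 4).
-/

set_option autoImplicit false

noncomputable section

open scoped Classical MatrixGroups ModularForm

open CongruenceSubgroup WeierstrassCurve NumberField Literature.NumberTheory.EllipticCurves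
  Literature.NumberTheory.EllipticCurves.ModularForms Literature.NumberTheory.QuadraticFields
  Literature.NumberTheory.EllipticCurves.Rank1Residual
  Literature.NumberTheory.EllipticCurves.Rank1Residual.Typed
  Literature.NumberTheory.EllipticCurves.CastellaGrossiLeeSkinner2022

namespace Summit.BirchSwinnertonDyer.Rank1Residual

/-! ### §1 (5.5) at a datum ⇒ the Heegner-index identity over `K`, every odd `p` -/

/-- **(5.5) ⇒ `X11b.IndexIdentityAt` at a Heegner datum with Manin constant prime to `p`, every odd
`p`.** As `RowC6.indexIdentityAt_of_display55` (session 3), with the Tamagawa transport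
`ord_p ∏_w c_w(E/K) = 2·ord_p ∏_ℓ c_ℓ(E/ℚ)` now the odd-`p` tree theorem
`X11b.padicValNat_tamagawaProduct_baseChange_quadratic_eq_two_mul_of_heegner_of_odd` (`p ∤ d_K` because
`p` splits in `K`, `not_dvd_discr_of_split`). [cite: CastellaGrossiLeeSkinner2022, proof of Thm. 5.3.1, display (5.5)]
[cite: JetchevSkinnerWan2017, §7.3.1 (eq:tamK) and §7.4.1] -/
theorem RowC6.indexIdentityAt_of_display55_of_odd (h55 : display55_sha_heegnerIndex)
    (W : WeierstrassCurve ℚ) [W.IsElliptic] [W.IsGloballyMinimal] (p : ℕ) [Fact p.Prime]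
    (N : ℕ) [NeZero N] (K : Type) [Field K] [NumberField K]
    (Dt : ModularParametrizationData W N) (H : HeegnerDatum N (NumberField.discr K)) (ι : K →+* ℂ)
    (P : (W.baseChange K).toAffine.Point)
    (hp : 2 < p) (hgood : Good W p) (hred : Red W p) (hna : ¬ Anom W p) (hr : W.analyticRank = 1)
    (hN : W.conductorNorm ℤ = N) (hK : IsImaginaryQuadratic K) (hodd : Odd (NumberField.discr K))
    (hlt : NumberField.discr K < -4) (hHN : SatisfiesHeegnerHypothesis N K)
    (hHp : SatisfiesHeegnerHypothesis p K)
    (hLt : (W.quadraticTwist (NumberField.discr K : ℚ)).entireLFunction 1 ≠ 0)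
    (hP : WeierstrassCurve.Affine.Point.map ι.toRatAlgHom P = heegnerPointComplex Dt H)
    (hc : ¬ (p : ℤ) ∣ Dt.c) (hfin : Finite (W.baseChange K).sha) :
    X11b.IndexIdentityAt W p K P := by
  have hpP : p.Prime := Fact.out
  have hp2 : p ≠ 2 := by omega
  have hHN' : SatisfiesHeegnerHypothesis (W.conductorNorm ℤ) K := by rw [hN]; exact hHN
  have hpd : ¬ (p : ℤ) ∣ NumberField.discr K := not_dvd_discr_of_split hK hpP hp2 hHp
  -- the Tamagawa transport at the odd `p ∤ d_K` (every `ℓ ∣ N` splits)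
  have htamK : padicValNat p (W.baseChange K).tamagawaProduct = 2 * padicValNat p W.tamagawaProduct :=
    X11b.padicValNat_tamagawaProduct_baseChange_quadratic_eq_two_mul_of_heegner_of_odd W p K hp2 hK hodd
      hpd hHN'
  exact (X11b.indexIdentityAt_iff W p K P).mpr
    (indexIdentity_of_display55 h55 hp hgood hred hna hr K hK hodd hlt hHN' hHp hLt Dt H ι P hP hc
      htamK hfin)

/-- **(5.5) ⇒ STEP L (`X11b.IndexLowerBoundAt`) at the same datum, every odd `p`.**
[cite: CastellaGrossiLeeSkinner2022, proof of Thm. 5.3.1, display (5.5)]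
[cite: JetchevSkinnerWan2017, §7.4.1 (eq:shalowerK-1)] -/
theorem RowC6.indexLowerBoundAt_of_display55_of_odd (h55 : display55_sha_heegnerIndex)
    (W : WeierstrassCurve ℚ) [W.IsElliptic] [W.IsGloballyMinimal] (p : ℕ) [Fact p.Prime]
    (N : ℕ) [NeZero N] (K : Type) [Field K] [NumberField K]
    (Dt : ModularParametrizationData W N) (H : HeegnerDatum N (NumberField.discr K)) (ι : K →+* ℂ)
    (P : (W.baseChange K).toAffine.Point)
    (hp : 2 < p) (hgood : Good W p) (hred : Red W p) (hna : ¬ Anom W p) (hr : W.analyticRank = 1)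
    (hN : W.conductorNorm ℤ = N) (hK : IsImaginaryQuadratic K) (hodd : Odd (NumberField.discr K))
    (hlt : NumberField.discr K < -4) (hHN : SatisfiesHeegnerHypothesis N K)
    (hHp : SatisfiesHeegnerHypothesis p K)
    (hLt : (W.quadraticTwist (NumberField.discr K : ℚ)).entireLFunction 1 ≠ 0)
    (hP : WeierstrassCurve.Affine.Point.map ι.toRatAlgHom P = heegnerPointComplex Dt H)
    (hc : ¬ (p : ℤ) ∣ Dt.c) (hfin : Finite (W.baseChange K).sha) :
    X11b.IndexLowerBoundAt W p K P :=
  X11b.indexLowerBoundAt_of_indexIdentityAt W p K P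
    (RowC6.indexIdentityAt_of_display55_of_odd h55 W p N K Dt H ι P hp hgood hred hna hr hN hK hodd hlt
      hHN hHp hLt hP hc hfin)

/-! ### §2 Pointwise: (5.5) + the twist's rank-zero print shape ⇒ `BSD(E,p)`, every odd `p` -/

/-- **Row C6 ∩ {r = 1} at a Heegner datum, every odd `p`, from (5.5) and the partner's rank-zero print
shape** — as `RowC6.bsdp_rankOne_at_of_display55_of_partner` (session 3) with both transport values
the odd-`p` tree theorems (`X2.padicValNat_tamagawaProduct_twist_of_heegner_of_odd`,
`RowC6.indexIdentityAt_of_display55_of_odd`). [cite: CastellaGrossiLeeSkinner2022, proof of Thm. 5.3.1, (5.5)–(5.7)]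
[cite: JetchevSkinnerWan2017, §7.4.1 (eq:gz for K′), p. 30] [cite: Miller2011LMS, Def. 1.1] -/
theorem RowC6.bsdp_rankOne_at_of_display55_of_partner_of_odd (h55 : display55_sha_heegnerIndex)
    (W : WeierstrassCurve ℚ) [W.IsElliptic] [W.IsGloballyMinimal] (p : ℕ) [Fact p.Prime]
    (N : ℕ) [NeZero N] (K : Type) [Field K] [NumberField K]
    (Dt : ModularParametrizationData W N) (H : HeegnerDatum N (NumberField.discr K)) (ι : K →+* ℂ)
    (P : (W.baseChange K).toAffine.Point)
    (hGZ : gross_zagier N W K) (hKo : kolyvagin N W K)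
    (hGZK : rank_eq_analyticRank_of_analyticRank_le_one) (hmod : hasEntireLFunction_rat)
    (hp : 2 < p) (hgood : Good W p) (hred : Red W p) (hna : ¬ Anom W p) (hr : W.analyticRank = 1)
    (hN : W.conductorNorm ℤ = N) (hK : IsImaginaryQuadratic K) (hodd : Odd (NumberField.discr K))
    (hlt : NumberField.discr K < -4) (hHN : SatisfiesHeegnerHypothesis N K)
    (hHp : SatisfiesHeegnerHypothesis p K)
    (hLt : (W.quadraticTwist (NumberField.discr K : ℚ)).entireLFunction 1 ≠ 0)
    (hP : WeierstrassCurve.Affine.Point.map ι.toRatAlgHom P = heegnerPointComplex Dt H)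
    (hc : ¬ (p : ℤ) ∣ Dt.c)
    (Wd : WeierstrassCurve ℚ) [Wd.IsElliptic] [Wd.IsGloballyMinimal] (Cd : VariableChange ℚ)
    (hWd : Cd • W.quadraticTwist (NumberField.discr K : ℚ) = Wd) (htw : PPartRankZero Wd p) :
    BSDp W p := by
  have hpP : p.Prime := Fact.out
  have hp2 : p ≠ 2 := by omega
  have hHN' : SatisfiesHeegnerHypothesis (W.conductorNorm ℤ) K := by rw [hN]; exact hHN
  have hpd : ¬ (p : ℤ) ∣ NumberField.discr K := not_dvd_discr_of_split hK hpP hp2 hHp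
  have hμ : ¬ p ∣ Units.torsionOrder K := X2.not_dvd_unitsTorsionOrder_of_discr_lt hK hlt hpP hp2
  have htam : padicValNat p Wd.tamagawaProduct = padicValNat p W.tamagawaProduct :=
    X2.padicValNat_tamagawaProduct_twist_of_heegner_of_odd W p hp2 K hK hodd hpd hHN' Cd hWd
  have hu : padicValRat p (Cd.u : ℚ) = 0 :=
    AdditivePotMult.padicValRat_u_eq_zero_of_twist_minimal_of_split W p K hK hHp Cd hWd
  exact X11b.bsdp_of_indexIdentityAt W p N K Dt H ι P hGZ hKo hGZK hmod hK hHN hP hp2 hc hμ hr hLt Wd Cd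
    hWd htw htam hu
    (RowC6.indexIdentityAt_of_display55_of_odd h55 W p N K Dt H ι P hp hgood hred hna hr hN hK hodd hlt
      hHN hHp hLt hP hc)

/-- **Row C6 ∩ {r = 1} at a Heegner datum, every odd `p`, from (5.5) and CGS 2025 Theorem A for the
partner** ("applying our result in the rank `0` case to `E^K`"): as
`RowC6.bsdp_rankOne_at_of_display55_of_cgsThmA` (session 3) at `2 < p`.
[cite: CastellaGrossiSkinner2025, Thm. D and its proof (§0.3 p. 5), Theorem A]
[cite: CastellaGrossiLeeSkinner2022, proof of Thm. 5.3.1, (5.5)] [cite: GreenbergLNM1716, Thm. 4.1 (p. 102)] -/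
theorem RowC6.bsdp_rankOne_at_of_display55_of_cgsThmA_of_odd (h55 : display55_sha_heegnerIndex)
    (hA : CastellaGrossiSkinner2025.thmA_charIdeal_eq_padicLFunction)
    (hGr : greenberg_charValue_rankZero) (hmodP : nonempty_modularParametrizationData)
    (W : WeierstrassCurve ℚ) [W.IsElliptic] [W.IsGloballyMinimal] (p : ℕ) [Fact p.Prime]
    (N : ℕ) [NeZero N] (K : Type) [Field K] [NumberField K]
    (Dt : ModularParametrizationData W N) (H : HeegnerDatum N (NumberField.discr K)) (ι : K →+* ℂ)
    (P : (W.baseChange K).toAffine.Point)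
    (hGZ : gross_zagier N W K) (hKo : kolyvagin N W K)
    (hGZK : rank_eq_analyticRank_of_analyticRank_le_one) (hmod : hasEntireLFunction_rat)
    (hp : 2 < p) (hgood : Good W p) (hred : Red W p) (hna : ¬ Anom W p) (hr : W.analyticRank = 1)
    (hN : W.conductorNorm ℤ = N) (hK : IsImaginaryQuadratic K) (hodd : Odd (NumberField.discr K))
    (hlt : NumberField.discr K < -4) (hHN : SatisfiesHeegnerHypothesis N K)
    (hHp : SatisfiesHeegnerHypothesis p K)
    (hLt : (W.quadraticTwist (NumberField.discr K : ℚ)).entireLFunction 1 ≠ 0)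
    (hP : WeierstrassCurve.Affine.Point.map ι.toRatAlgHom P = heegnerPointComplex Dt H)
    (hc : ¬ (p : ℤ) ∣ Dt.c)
    (Wd : WeierstrassCurve ℚ) [Wd.IsElliptic] [Wd.IsGloballyMinimal] (Cd : VariableChange ℚ)
    (hWd : Cd • W.quadraticTwist (NumberField.discr K : ℚ) = Wd) : BSDp W p := by
  -- `∃ C, C • Wd = E^{(d_K)}` (the inverse change of variables)
  have hWd' : ∃ C : VariableChange ℚ, C • Wd = W.quadraticTwist (NumberField.discr K : ℚ) :=
    ⟨Cd⁻¹, by rw [← hWd, inv_smul_smul]⟩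
  -- the partner is good, Eisenstein and non-anomalous at `p`, of analytic rank `0`
  obtain ⟨hgood_d, hred_d, hna_d⟩ :=
    partner_good_red_not_anom hp hgood hred hna K hK hodd hHp Wd hWd'
  have hord_d : GoodOrd Wd p := goodOrd_of_red_of_good Wd p hp hgood_d hred_d
  have hd0 : (NumberField.discr K : ℚ) ≠ 0 := by exact_mod_cast NumberField.discr_ne_zero K
  haveI hEt : (W.quadraticTwist (NumberField.discr K : ℚ)).IsElliptic := W.isElliptic_quadraticTwist hd0
  have hLt' : (W.quadraticTwist (NumberField.discr K : ℚ)).entireLFunction = Wd.entireLFunction := by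
    rw [← hWd, entireLFunction_smul]
  have hLd : Wd.entireLFunction 1 ≠ 0 := by rw [← hLt']; exact hLt
  -- Theorem A + Greenberg 4.1 + GZK: the rank-zero print shape of the partner
  have htw : PPartRankZero Wd p :=
    CastellaGrossiSkinner2025.pPartRankZero_of_thmA hA hmodP hGZK Wd p hp hgood_d hred_d hna_d hLd
      (fun κ γ hκ hγ hγ' D _ hX fE hfE hSel ↦
        hGr Wd p (by omega) hgood_d hord_d.2 κ γ hκ hγ hγ' D hX fE hfE hSel)
  exact RowC6.bsdp_rankOne_at_of_display55_of_partner_of_odd h55 W p N K Dt H ι P hGZ hKo hGZK hmod hp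
    hgood hred hna hr hN hK hodd hlt hHN hHp hLt hP hc Wd Cd hWd htw

/-! ### §3 Class level at every odd `p`: the Manin condition moved to the optimal curve (Mazur) and Cassels -/

/-- **Row C6 ∩ {r = 1}, CLASS LEVEL at every ODD `p`, along the printed anticyclotomic route at the
level of (5.5): for every globally minimal elliptic `E/ℚ` with `ord_{s=1}L(E,s) = 1` and every GOOD
prime `p > 2` with `E[p]` reducible and `a_p ≢ 1 (mod p)`, Miller's `BSD(E,p)`** — from the typed
display (5.5) (`h55`), the typed CGS Theorem A (`hA`) and PUBLISHED named facts only (Greenberg Thm. 4.1,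
modularity, Hoffstein–Luo, Gross–Zagier, Kolyvagin, GZK, Mazur 1978 Cor. 4.1, Cassels); NO per-pair
binder. The proof is that of `RowC6.bsdp_rankOne_of_display55_of_cgsThmA` (session 3): the
`X₀(N)`-optimal curve `E₀ ∼ E` has `p ∤ c₀` (Mazur, `p` odd good), is again in row C6 with `r = 1`, gets
`BSD(E₀,p)` pointwise (`…_at_of_display55_of_cgsThmA_of_odd`), and Cassels transfers it to `E`. This puts
row C6 ∩ {r = 1, p = 3} on the (5.5) route as well. [cite: CastellaGrossiLeeSkinner2022, proof of Thm. 5.3.1, (5.4)–(5.7)]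
[cite: CastellaGrossiSkinner2025, Thm. D and its proof (§0.3 p. 5), Theorem A]
[cite: Mazur1978, Cor. 4.1] [cite: MilneADT2006, Thm. I.7.3] [cite: HoffsteinLuo1997, Theorem (§1)]
[cite: Miller2011LMS, Def. 1.1] -/
theorem RowC6.bsdp_rankOne_of_display55_of_cgsThmA_of_odd (h55 : display55_sha_heegnerIndex)
    (hA : CastellaGrossiSkinner2025.thmA_charIdeal_eq_padicLFunction)
    (hGr : greenberg_charValue_rankZero) (hmodP : nonempty_modularParametrizationData)
    (hnf : exists_isNewformOf) (hHL : HoffsteinLuo1997_exists_twist_L_one_ne_zero)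
    (hGZ : ∀ (N : ℕ) [NeZero N] (W : WeierstrassCurve ℚ) (K : Type) [Field K] [NumberField K],
      gross_zagier N W K)
    (hKo : ∀ (N : ℕ) [NeZero N] (W : WeierstrassCurve ℚ) (K : Type) [Field K] [NumberField K],
      kolyvagin N W K)
    (hGZK : rank_eq_analyticRank_of_analyticRank_le_one)
    (hMaz : mazur_not_dvd_maninConstant_of_odd) (hCassels : bsdRHS_eq_of_isIsogenous)
    (W : WeierstrassCurve ℚ) [W.IsElliptic] [W.IsGloballyMinimal] (p : ℕ) [Fact p.Prime]
    (hp : 2 < p) (hgood : Good W p) (hred : Red W p) (hna : ¬ Anom W p) (hr : W.analyticRank = 1) :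
    BSDp W p := by
  have hpP : p.Prime := Fact.out
  have hp2 : p ≠ 2 := by omega
  have hmod : hasEntireLFunction_rat := WeierstrassCurve.hasEntireLFunction_rat_of_exists_isNewformOf hnf
  haveI : NeZero (W.conductorNorm ℤ) := ⟨(W.conductorNorm_pos_holds).ne'⟩
  ---------------------------------------------------------------- the optimal curve of the class
  obtain ⟨W₀, hE₀, hM₀, D₀, -, hiso, hmin⟩ :=
    Literature.NumberTheory.Automorphic.exists_optimal_modularParametrizationData_of_modularity hnf
      (W.conductorNorm ℤ) W rfl
  haveI := hE₀
  haveI := hM₀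
  -- `D₀` is lattice-optimal: compare with the unconditional optimal datum of the same newform
  obtain ⟨W₁, hE₁, D₁, hf₁, hlat₁⟩ := D₀.exists_optimalDatum'
  haveI := hE₁
  have hlat₀ : ∀ z ∈ D₀.L.lattice, ∃ w ∈ periodLattice D₀.f, z = D₀.c * w :=
    D₀.latticeEq_of_modularDegree_le D₁ hf₁ hlat₁ (hmin W₁ D₁ hf₁)
  -- Mazur's Cor. 4.1 at the odd good prime `p` (`p ∤ N`, a fortiori `p² ∤ N`)
  have hpN : ¬ p ∣ W.conductorNorm ℤ := fun h ↦
    ((W.dvd_conductorNorm_iff_not_hasGoodReductionAtPrime p).mp h) hgood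
  have hsq : ¬ p ^ 2 ∣ W.conductorNorm ℤ := fun h ↦ hpN ((dvd_pow_self p two_ne_zero).trans h)
  have hc₀ : ¬ (p : ℤ) ∣ D₀.c := hMaz W₀ D₀ hlat₀ p hpP hp2 hsq
  -- the level of `D₀` is the conductor of `W₀` as well
  have hN : W.conductorNorm ℤ = W₀.conductorNorm ℤ :=
    IsNewformOf.level_eq_conductorNorm_of_exists_isNewformOf hnf D₀.isNewformOf
  ---------------------------------------------------------------- `W₀` is again in row C6, rank one
  obtain ⟨hgood₀, hred₀, hna₀, hr₀⟩ := RowC6.of_isIsogenous hiso hgood hred hna hr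
  ---------------------------------------------------------------- the admissible field (Hoffstein–Luo)
  have hw₀ : W₀.rootNumber = -1 := by
    have h := even_analyticRank_iff_rootNumber_eq_one.rootNumber_eq_neg_one_pow (W := W₀)
      (even_analyticRank_iff_rootNumber_eq_one_of_exists_isNewformOf W₀ hnf)
    rw [hr₀, pow_one] at h
    exact h
  obtain ⟨K, _, _, hK, hodd, hlt, hHN₀, hHp, hLt⟩ :=
    exists_admissibleField_of_rootNumber_eq_neg_one hnf hHL W₀ hw₀ p
  have hHN : SatisfiesHeegnerHypothesis (W.conductorNorm ℤ) K := by rw [hN]; exact hHN₀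
  ---------------------------------------------------------------- the Heegner datum of `W₀` over `K`
  obtain ⟨β, hβ⟩ := exists_dvd_sq_sub_discr_holds (W.conductorNorm ℤ) K hK hHN
  obtain ⟨H, -⟩ := nonempty_heegnerDatum_holds (W.conductorNorm ℤ) K hK hβ
  obtain ⟨ι⟩ : Nonempty (K →+* ℂ) := inferInstance
  obtain ⟨P, hP⟩ := heegnerPointComplex_mem_range_map_holds (W.conductorNorm ℤ) W₀ K hK hHN D₀ H ι
  ---------------------------------------------------------------- a globally minimal model of the twist
  have hd0 : (NumberField.discr K : ℚ) ≠ 0 := by exact_mod_cast NumberField.discr_ne_zero K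
  obtain ⟨Wd, _, _, C, hC⟩ := exists_isGloballyMinimal_smul_eq_quadraticTwist W₀ hd0
  have hWd : C⁻¹ • W₀.quadraticTwist (NumberField.discr K : ℚ) = Wd := by rw [← hC, inv_smul_smul]
  ---------------------------------------------------------------- `BSD(E₀,p)`, then Cassels
  have h₀ : BSDp W₀ p :=
    RowC6.bsdp_rankOne_at_of_display55_of_cgsThmA_of_odd h55 hA hGr hmodP W₀ p (W.conductorNorm ℤ) K
      D₀ H ι P (hGZ _ W₀ K) (hKo _ W₀ K) hGZK hmod hp hgood₀ hred₀ hna₀ hr₀ hN.symm hK hodd hlt hHN hHp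
      hLt hP hc₀ Wd C⁻¹ hWd
  exact X2.bsdp_of_isIsogenous_of_bsdp hCassels hGZK hmod W₀ W hiso.symm_of_charZero p (by rw [hr₀]) h₀

/-- **Row C6 ∩ {r = 1}, every odd `p`, in the row vocabulary** (`RowC6 W p := 2 < p ∧ Red W p ∧
Good W p ∧ ¬ Anom W p`, `Partition/Rows.lean`): `RowC6 W p → ord_{s=1}L(E,s) = 1 → BSDp W p` from the
typed (5.5), the typed Theorem A and published facts — no `5 ≤ p`.
[cite: CastellaGrossiSkinner2025, Thm. D (r = 1)] [cite: CastellaGrossiLeeSkinner2022, proof of Thm. 5.3.1, (5.5)] -/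
theorem RowC6.bsdp_rankOne_of_display55_of_cgsThmA_of_odd' (h55 : display55_sha_heegnerIndex)
    (hA : CastellaGrossiSkinner2025.thmA_charIdeal_eq_padicLFunction)
    (hGr : greenberg_charValue_rankZero) (hmodP : nonempty_modularParametrizationData)
    (hnf : exists_isNewformOf) (hHL : HoffsteinLuo1997_exists_twist_L_one_ne_zero)
    (hGZ : ∀ (N : ℕ) [NeZero N] (W : WeierstrassCurve ℚ) (K : Type) [Field K] [NumberField K],
      gross_zagier N W K)
    (hKo : ∀ (N : ℕ) [NeZero N] (W : WeierstrassCurve ℚ) (K : Type) [Field K] [NumberField K],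
      kolyvagin N W K)
    (hGZK : rank_eq_analyticRank_of_analyticRank_le_one)
    (hMaz : mazur_not_dvd_maninConstant_of_odd) (hCassels : bsdRHS_eq_of_isIsogenous)
    (W : WeierstrassCurve ℚ) [W.IsElliptic] [W.IsGloballyMinimal] (p : ℕ) [Fact p.Prime]
    (hC6 : RowC6 W p) (hr : W.analyticRank = 1) : BSDp W p :=
  RowC6.bsdp_rankOne_of_display55_of_cgsThmA_of_odd h55 hA hGr hmodP hnf hHL hGZ hKo hGZK hMaz hCassels
    W p hC6.1 hC6.2.2.1 hC6.2.1 hC6.2.2.2 hr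

end Summit.BirchSwinnertonDyer.Rank1Residual

end
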